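import Literature.NumberTheory.GaloisRepresentations.CorNaturality
import Literature.NumberTheory.GaloisRepresentations.ShapiroIsomorphism
import Literature.NumberTheory.GaloisRepresentations.ShapiroVanishing
import Literature.GroupTheory.Transfer.TransferTransitivity
import HarnessLib

/-!
# Transitivity of the corestriction in all degrees: `cor_{G/S} ∘ cor_{S/S'} = cor_{G/S'}` (Serre I §2.5)

Topic `NumberTheory/GaloisRepresentations`; namespace `Literature.NumberTheory.GaloisRepresentations`.
Definitions with bodies (two comparison morphisms of induced modules) and theorems; no named fact,
no instance, no `sorry`.

For a profinite group `G`, closed subgroups `S' ≤ S ≤ G` of finite index and a discrete `G`-module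
`M` (`ρ`), the tree's corestriction `cor S ρ q : H^q(S, M) → H^q(G, M)` (`Corestriction.lean`: the
Shapiro extension map followed by the norm `M_G^S(M) → M`, Serre, *Cohomologie galoisienne*, I §2.5)
is TRANSITIVE in every degree `q`:

  `cor_{G/S} (cor_{S/S'} z) = cor_{G/S'} z`      (`cor_cor_subgroupOf`)

where `cor_{S/S'}` is the corestriction of the profinite group `↥S` along its subgroup
`S'.subgroupOf S` and `z ∈ H^q(S', M)` is read in `H^q(S'.subgroupOf S, M)` through the tautological
comparison `toSubgroupOf` of `ContinuousCorestriction.lean`. The degree-`1` transfer corestriction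
`cores`/`coresLe` already has this (`cores_coresLe_eq_cores`, `ContinuousCorestrictionTransitive.lean`);
the present all-degree statement is what degree-`2` consumers need (local invariants of open
subgroups `inv_S := inv ∘ cor_{G/S}` on `H²(S, μₙ)`: `inv_S ∘ cor_{S/S'} = inv_{S'}`; the finite-level
local Tate pairings along a `ℤ_p`-tower, K3 of the BSD cell).

Proof (Serre I §2.5, "`M_G^S(M_S^{S'}(A)) = M_G^{S'}(A)`"): `cor = H(norm) ∘ sh⁻¹` with `sh` the
Shapiro isomorphism (`cor_apply`, `sh_extMap`, `shapiro_map_bijective`); the induced modules compose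
through `Ψ : M_G^S(M_S^{S'}(M)) → M_G^{S'}(M)`, `Ψ(F)(g) = F(g)(1)` (`coindTransHom`), which
intertwines the evaluations at `1` (`coindEvalOne_coindTransHom`) and the norms
(`normCoind_coindTransHom`: `Σ_{G/S'} = Σ_{G/S} Σ_{S/S'}` on the product system of coset
representatives, the tree's `Literature.GroupTheory.Transfer.prodSection_bijective`); and the Shapiro
map is natural in morphisms of `S`-modules (`shapiro_coindMap`, here for ARBITRARY discrete
`S`-modules, extending `cohomologyMap_shMap` of `CorNaturality.lean`).

## Main statements

* `shapiro_coindMap` — `sh ∘ H(M_G^S(f)) = H(f) ∘ sh` for the tree's `coindMap f : M_G^S(A₁) → M_G^S(A₂)`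
  (`ShapiroVanishing.lean`) of a morphism `f : A₁ → A₂` of ARBITRARY discrete `S`-modules (the tree's
  `cohomologyMap_shMap` is the case of restricted `G`-modules); `evalOneThen'` is the auxiliary morphism;
* `extMap_eq_of_shMap_eq`, `extMap_shMap_all` — `ext = sh⁻¹` in every degree;
* `coindTransHom` (`Ψ`), `coindTransHom_coe_apply`, `normCoind_coindTransHom` (`N_{G/S'} ∘ Ψ =
  N_{G/S} ∘ M_G^S(N_{S/S'})`), with the shorthands `repSub` (`M|_{S'.subgroupOf S}`), `coindSub`
  (`M_S^{S'}(M)`) and the evaluation morphisms `evalTwice`, `evalTwice'`;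
* `toSubgroupOfHom : S' →ₜ* S'.subgroupOf S`, `ofSubgroupOf : H^q(S'.subgroupOf S, M) → H^q(S', M)`;
* `extMap_cohomologyMap_normCoind_shapiro`, `ofSubgroupOf_shMap_shapiro`, `cor_cor_shapiro` — the steps;
* **`cor_cor_subgroupOf`** — transitivity of `cor` in all degrees.

## References
* J.-P. Serre, *Galois Cohomology* (1997), I §2.5 (induced modules, Prop. 10, corestriction). [SerreGaloisCohomology1997]
* J. Neukirch, A. Schmidt, K. Wingberg, *Cohomology of Number Fields* (2008), I §5, Prop. 1.5.3 (iii)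
  (`cor` is transitive). [NeukirchSchmidtWingberg2008]
-/

noncomputable section

open CategoryTheory Function

universe u

namespace Literature.NumberTheory.GaloisRepresentations

open _root_.TopRep _root_.ContRepresentation _root_.ContinuousCohomology

/-! ### §1 Functoriality of `M_G^S(·)` in arbitrary `S`-modules and naturality of the Shapiro map -/

section CoindMapGeneral

variable {G : Type u} [Group G] [TopologicalSpace G] [IsTopologicalGroup G] [CompactSpace G]
variable {S : Subgroup G}
variable {A₁ A₂ : Type u} [AddCommGroup A₁] [TopologicalSpace A₁] [DiscreteTopology A₁]
  [AddCommGroup A₂] [TopologicalSpace A₂] [DiscreteTopology A₂]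
variable (σ₁ : ContinuousRep S ℤ A₁) (σ₂ : ContinuousRep S ℤ A₂)

attribute [local instance] discreteTopology_coind

/-- The composite `M_G^S(A₁) → A₁ → A₂` (evaluation at `1`, then `f`), as a morphism along `S ↪ G`.
[cite: SerreGaloisCohomology1997, I §2.5] -/
def evalOneThen' (f : σ₁.toTopRep ⟶ σ₂.toTopRep) :
    TopRep.res (subgroupIncl S : S →* G) (coindRep σ₁).toTopRep ⟶ σ₂.toTopRep :=
  TopRep.ofHom
    { toLinearMap := f.hom.toLinearMap.comp (coindEvalOne σ₁).hom.toLinearMap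
      cont := continuous_of_discreteTopology
      isIntertwining' := fun s => by
        ext F
        change f.hom ((((coindRep σ₁) (subgroupIncl S s) F : coindModule σ₁) : C(G, A₁)) 1) =
          σ₂ s (f.hom (((F : coindModule σ₁) : C(G, A₁)) 1))
        have hF := (mem_coind_iff σ₁ _).1 F.2 s 1
        rw [mul_one] at hF
        rw [coindRep_apply_apply, one_mul, subgroupIncl_apply, hF]
        exact TopRep.hom_comm_apply f s _ }

/-- **Naturality of the Shapiro map in morphisms of `S`-modules** (any discrete `S`-modules):
`H^q(f) (sh y) = sh (H^q(M_G^S(f)) y)`. [cite: SerreGaloisCohomology1997, I §2.5 Prop. 10] -/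
theorem shapiro_coindMap (f : σ₁.toTopRep ⟶ σ₂.toTopRep) (q : ℕ)
    (y : continuousCohomology q (coindRep σ₁).toTopRep) :
    cohomologyMap f q (ContinuousCohomology.map (subgroupIncl S) (coindEvalOne σ₁) q y) =
      ContinuousCohomology.map (subgroupIncl S) (coindEvalOne σ₂) q (cohomologyMap (coindMap f) q y) := by
  have h1 : ContinuousCohomology.map (subgroupIncl S) (evalOneThen' σ₁ σ₂ f) q y =
      cohomologyMap f q (ContinuousCohomology.map (subgroupIncl S) (coindEvalOne σ₁) q y) :=
    map_comp_apply_of (subgroupIncl S) (ContinuousMonoidHom.id S) (subgroupIncl S) (fun _ => rfl)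
      (coindEvalOne σ₁) (resIdHom f) (evalOneThen' σ₁ σ₂ f) (fun _ => rfl) q y
  have h2 : ContinuousCohomology.map (subgroupIncl S) (evalOneThen' σ₁ σ₂ f) q y =
      ContinuousCohomology.map (subgroupIncl S) (coindEvalOne σ₂) q (cohomologyMap (coindMap f) q y) :=
    map_comp_apply_of (ContinuousMonoidHom.id G) (subgroupIncl S) (subgroupIncl S) (fun _ => rfl)
      (resIdHom (coindMap f)) (coindEvalOne σ₂) (evalOneThen' σ₁ σ₂ f) (fun _ => rfl) q y
  rw [← h1, h2]

end CoindMapGeneral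

/-! ### §2 `ext = sh⁻¹` in every degree -/

section ExtSh

variable {G : Type u} [Group G] [TopologicalSpace G] [IsTopologicalGroup G] [CompactSpace G]
  [T2Space G] [TotallyDisconnectedSpace G]
variable (S : Subgroup G) [hS : IsClosed (S : Set G)]
variable {M : Type u} [AddCommGroup M] [TopologicalSpace M] [DiscreteTopology M]
variable (ρ : ContinuousRep G ℤ M)

attribute [local instance] compactSpace_of_isClosed_subgroup

/-- **`ext` is the inverse of `sh` in every degree**: if `sh y = z` then `ext z = y`
(`sh ∘ ext = id` and `sh` is injective, Serre I §2.5 Prop. 10). [cite: SerreGaloisCohomology1997, I §2.5 Prop. 10] -/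
theorem extMap_eq_of_shMap_eq (q : ℕ) {y : continuousCohomology q (coindRep (ρ.restrict (subgroupIncl S))).toTopRep}
    {z : continuousCohomology q (ρ.restrict (subgroupIncl S)).toTopRep} (h : shMap S ρ q y = z) :
    extMap S ρ q z = y := by
  apply shapiro_map_injective (ρ.restrict (subgroupIncl S)) q
  change shMap S ρ q (extMap S ρ q z) = shMap S ρ q y
  rw [sh_extMap, h]

/-- `ext (sh y) = y` in every degree (degree `0` included; the tree's `extMap_sh` is stated in
positive degrees). [cite: SerreGaloisCohomology1997, I §2.5 Prop. 10] -/
theorem extMap_shMap_all (q : ℕ) (y : continuousCohomology q (coindRep (ρ.restrict (subgroupIncl S))).toTopRep) :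
    extMap S ρ q (shMap S ρ q y) = y :=
  extMap_eq_of_shMap_eq S ρ q rfl

end ExtSh

/-! ### §3 `M_G^S(M_S^{S'}(M)) → M_G^{S'}(M)` and its compatibility with evaluations and norms -/

section Trans

variable {G : Type u} [Group G] [TopologicalSpace G] [IsTopologicalGroup G] [CompactSpace G]
  [T2Space G] [TotallyDisconnectedSpace G]
variable (S S' : Subgroup G) [hS : IsClosed (S : Set G)] [hS' : IsClosed (S' : Set G)]
variable {M : Type u} [AddCommGroup M] [TopologicalSpace M] [DiscreteTopology M]
variable (ρ : ContinuousRep G ℤ M)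

attribute [local instance] compactSpace_of_isClosed_subgroup discreteTopology_coind

omit [IsTopologicalGroup G] [CompactSpace G] [T2Space G] [TotallyDisconnectedSpace G] hS in
/-- `S'.subgroupOf S` is closed in `↥S` (preimage of the closed `S'`); used as a local instance.
[cite: SerreGaloisCohomology1997, I §1.1] -/
theorem isClosed_subgroupOf_of_isClosed : IsClosed ((S'.subgroupOf S : Subgroup S) : Set S) :=
  hS'.preimage continuous_subtype_val

attribute [local instance] isClosed_subgroupOf_of_isClosed

/-- Shorthand: `M` as a module over `S'.subgroupOf S ≤ ↥S` (restriction of `M|_S`).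
[cite: SerreGaloisCohomology1997, I §2.5] -/
abbrev repSub : ContinuousRep (S'.subgroupOf S : Subgroup S) ℤ M :=
  (ρ.restrict (subgroupIncl S)).restrict (subgroupIncl (S'.subgroupOf S))

/-- Shorthand: the `S`-module `M_S^{S'}(M)` (the induced module of the profinite group `↥S` along
`S'.subgroupOf S`, coefficients `M|_{S'}`). [cite: SerreGaloisCohomology1997, I §2.5] -/
abbrev coindSub : ContinuousRep S ℤ (coindModule (repSub S S' ρ)) :=
  coindRep (repSub S S' ρ)

omit [T2Space G] [TotallyDisconnectedSpace G] hS' in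
/-- For `F ∈ M_G^S(M_S^{S'}(M))`: `F(x)(s) = F(s x)(1)` (`F` is `S`-equivariant and `S` acts on
`M_S^{S'}(M)` by right translation). [cite: SerreGaloisCohomology1997, I §2.5] -/
theorem coe_apply_apply_eq_one (F : coindModule (coindSub S S' ρ)) (x : G) (s : S) :
    (((F : C(G, coindModule (repSub S S' ρ))) x : coindModule (repSub S S' ρ)) : C(S, M)) s =
      (((F : C(G, coindModule (repSub S S' ρ))) ((s : G) * x) : coindModule (repSub S S' ρ)) :
        C(S, M)) 1 := by
  have hF := (mem_coind_iff (coindSub S S' ρ) _).1 F.2 s x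
  change ((F : C(G, coindModule (repSub S S' ρ))) ((s : G) * x)) = _ at hF
  rw [hF, coindRep_apply_apply, one_mul]

omit [T2Space G] [TotallyDisconnectedSpace G] hS' in
/-- For `F ∈ M_G^S(M_S^{S'}(M))` and `s' ∈ S'`: `F(s' x)(1) = s' · F(x)(1)`. [cite: SerreGaloisCohomology1997, I §2.5] -/
theorem coe_apply_mul_apply_one (h : S' ≤ S) (F : coindModule (coindSub S S' ρ)) (x : G) (s' : S') :
    (((F : C(G, coindModule (repSub S S' ρ))) ((s' : G) * x) : coindModule (repSub S S' ρ)) :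
        C(S, M)) 1 =
      ρ (s' : G) ((((F : C(G, coindModule (repSub S S' ρ))) x : coindModule (repSub S S' ρ)) :
        C(S, M)) 1) := by
  have e := coe_apply_apply_eq_one S S' ρ F x ⟨(s' : G), h s'.2⟩
  have hFx := (mem_coind_iff (repSub S S' ρ) _).1
    ((F : C(G, coindModule (repSub S S' ρ))) x).2 ⟨⟨(s' : G), h s'.2⟩, s'.2⟩ 1
  rw [mul_one] at hFx
  exact e.symm.trans hFx

/-- **`Ψ : M_G^S(M_S^{S'}(M)) → M_G^{S'}(M)`, `Ψ(F)(g) = F(g)(1)`** (for `S' ≤ S`) — the comparison of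
the iterated induced module with the induced module along `S' ≤ G` (Serre I §2.5; an isomorphism,
which is not needed here), a morphism of discrete `G`-modules. [cite: SerreGaloisCohomology1997, I §2.5] -/
def coindTransHom (h : S' ≤ S) :
    (coindRep (coindSub S S' ρ)).toTopRep ⟶ (coindRep (ρ.restrict (subgroupIncl S'))).toTopRep :=
  TopRep.ofHom
    { toLinearMap :=
        { toFun := fun F => ⟨⟨fun g => (((F : C(G, coindModule (repSub S S' ρ))) g :
                coindModule (repSub S S' ρ)) : C(S, M)) 1,
              (continuous_eval_const (1 : S)).comp
                (continuous_subtype_val.comp (F : C(G, coindModule (repSub S S' ρ))).continuous)⟩,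
              fun s' x => coe_apply_mul_apply_one S S' ρ h F x s'⟩
          map_add' := fun F F' => Subtype.ext (ContinuousMap.ext fun x => rfl)
          map_smul' := fun c F => Subtype.ext (ContinuousMap.ext fun x => rfl) }
      cont := continuous_of_discreteTopology
      isIntertwining' := fun g => by ext F x; rfl }

omit [T2Space G] [TotallyDisconnectedSpace G] hS' in
/-- `Ψ` on elements: `Ψ(F)(g) = F(g)(1)`. [cite: SerreGaloisCohomology1997, I §2.5] -/
@[simp] theorem coindTransHom_coe_apply (h : S' ≤ S) (F : coindModule (coindSub S S' ρ)) (g : G) :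
    (((coindTransHom S S' ρ h).hom F : coindModule (ρ.restrict (subgroupIncl S'))) : C(G, M)) g =
      (((F : C(G, coindModule (repSub S S' ρ))) g : coindModule (repSub S S' ρ)) : C(S, M)) 1 :=
  rfl

variable [Fintype (G ⧸ S)] [Fintype (G ⧸ S')] [Fintype (S ⧸ S'.subgroupOf S)]

omit [T2Space G] [TotallyDisconnectedSpace G] hS' [Fintype (G ⧸ S)] [Fintype (G ⧸ S')]
  [Fintype (S ⧸ S'.subgroupOf S)] in
/-- One term of the double norm: `c̃ · N_{S/S'}-term = normTerm` of `Ψ F` at `c̃ d̃`.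
[cite: SerreGaloisCohomology1997, I §2.5] -/
theorem normTerm_coindTransHom (h : S' ≤ S) (F : coindModule (coindSub S S' ρ)) (c : G) (d : S) :
    ρ c ((ρ.restrict (subgroupIncl S)) d
        ((((F : C(G, coindModule (repSub S S' ρ))) c⁻¹ : coindModule (repSub S S' ρ)) : C(S, M)) d⁻¹)) =
      normTerm ρ ((coindTransHom S S' ρ h).hom F) (c * (d : G)) := by
  unfold normTerm
  rw [coindTransHom_coe_apply, mul_inv_rev, coe_apply_apply_eq_one S S' ρ F c⁻¹ d⁻¹,
    ContinuousRep.restrict_apply, subgroupIncl_apply, ← Module.End.mul_apply, ← map_mul]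
  rfl

omit [T2Space G] [TotallyDisconnectedSpace G] hS' in
/-- **`Ψ` intertwines the norms**: `N_{G/S'} ∘ Ψ = N_{G/S} ∘ M_G^S(N_{S/S'})` — the sum over `G/S'`
is the double sum over `G/S` and `S/S'` for the product system of representatives
(`Literature.GroupTheory.Transfer.prodSection_bijective`). [cite: SerreGaloisCohomology1997, I §2.5] -/
theorem normCoind_coindTransHom (h : S' ≤ S) (F : coindModule (coindSub S S' ρ)) :
    (normCoind (S := S') ρ).hom ((coindTransHom S S' ρ h).hom F) =
      (normCoind (S := S) ρ).hom
        ((coindMap (normCoind (S := S'.subgroupOf S) (ρ.restrict (subgroupIncl S)))).hom F) := by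
  classical
  have hR : (normCoind (S := S) ρ).hom
      ((coindMap (normCoind (S := S'.subgroupOf S) (ρ.restrict (subgroupIncl S)))).hom F) =
      ∑ x : (G ⧸ S) × (S ⧸ S'.subgroupOf S),
        normTerm ρ ((coindTransHom S S' ρ h).hom F) ((x.1.out : G) * ((x.2.out : S) : G)) := by
    rw [normCoind_hom_apply, Fintype.sum_prod_type]
    refine Finset.sum_congr rfl fun c _ ↦ ?_
    have h2 : (normCoind (S := S'.subgroupOf S) (ρ.restrict (subgroupIncl S))).hom
          ((F : C(G, coindModule (repSub S S' ρ))) (c.out : G)⁻¹) =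
        ∑ d : S ⧸ S'.subgroupOf S, (ρ.restrict (subgroupIncl S)) d.out
          ((((F : C(G, coindModule (repSub S S' ρ))) (c.out : G)⁻¹ : coindModule (repSub S S' ρ)) :
            C(S, M)) (d.out)⁻¹) := normCoind_hom_apply _ _
    calc ρ (c.out : G) ((((coindMap (normCoind (S := S'.subgroupOf S) (ρ.restrict (subgroupIncl S)))).hom F :
            coindModule (ρ.restrict (subgroupIncl S))) : C(G, M)) (c.out : G)⁻¹)
        = ρ (c.out : G) ((normCoind (S := S'.subgroupOf S) (ρ.restrict (subgroupIncl S))).hom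
            ((F : C(G, coindModule (repSub S S' ρ))) (c.out : G)⁻¹)) := rfl
      _ = ρ (c.out : G) (∑ d : S ⧸ S'.subgroupOf S, (ρ.restrict (subgroupIncl S)) d.out
            ((((F : C(G, coindModule (repSub S S' ρ))) (c.out : G)⁻¹ : coindModule (repSub S S' ρ)) :
              C(S, M)) (d.out)⁻¹)) := congrArg (ρ (c.out : G)) h2
      _ = ∑ d : S ⧸ S'.subgroupOf S, ρ (c.out : G) ((ρ.restrict (subgroupIncl S)) d.out
            ((((F : C(G, coindModule (repSub S S' ρ))) (c.out : G)⁻¹ : coindModule (repSub S S' ρ)) :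
              C(S, M)) (d.out)⁻¹)) := map_sum _ _ _
      _ = ∑ d : S ⧸ S'.subgroupOf S, normTerm ρ ((coindTransHom S S' ρ h).hom F)
            (((c, d).1.out : G) * (((c, d).2.out : S) : G)) :=
          Finset.sum_congr rfl fun d _ ↦ normTerm_coindTransHom S S' ρ h F c.out d.out
  have hL : (normCoind (S := S') ρ).hom ((coindTransHom S S' ρ h).hom F) =
      ∑ e : G ⧸ S', normTerm ρ ((coindTransHom S S' ρ h).hom F) (e.out : G) :=
    normCoind_hom_apply ρ _
  have hbij := Literature.GroupTheory.Transfer.prodSection_bijective (G := G) (H := S) (K := S') h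
    (ρ := fun c : G ⧸ S ↦ c.out) (fun q ↦ QuotientGroup.out_eq' q)
    (σ := fun d : S ⧸ S'.subgroupOf S ↦ d.out) (fun p ↦ QuotientGroup.out_eq' p)
  rw [hR, hL]
  symm
  exact Fintype.sum_bijective _ hbij _ _ fun x ↦
    normTerm_eq_of_coe_eq ρ _ (QuotientGroup.out_eq' _).symm

/-! ### §4 Transitivity -/

omit [IsTopologicalGroup G] [CompactSpace G] [T2Space G] [TotallyDisconnectedSpace G] hS hS'
  [Fintype (G ⧸ S)] [Fintype (G ⧸ S')] [Fintype (S ⧸ S'.subgroupOf S)] in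
/-- The continuous isomorphism `S' → S'.subgroupOf S` (inverse of the tree's `subgroupOfHom h`).
[folklore] -/
def toSubgroupOfHom (h : S' ≤ S) : S' →ₜ* (S'.subgroupOf S : Subgroup S) where
  toFun s := ⟨⟨(s : G), h s.2⟩, s.2⟩
  map_one' := rfl
  map_mul' _ _ := rfl
  continuous_toFun :=
    Continuous.subtype_mk (Continuous.subtype_mk continuous_subtype_val _) _

omit [IsTopologicalGroup G] [CompactSpace G] [T2Space G] [TotallyDisconnectedSpace G] hS hS'
  [Fintype (G ⧸ S)] [Fintype (G ⧸ S')] [Fintype (S ⧸ S'.subgroupOf S)] in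
/-- Unfolding `toSubgroupOfHom`: it is the identity on underlying elements of `G`.
[cite: SerreGaloisCohomology1997, I §2.5] -/
@[simp] theorem toSubgroupOfHom_coe_coe (h : S' ≤ S) (s : S') :
    (((toSubgroupOfHom S S' h s : S'.subgroupOf S) : S) : G) = s :=
  rfl

omit [T2Space G] [TotallyDisconnectedSpace G] hS hS'
  [Fintype (G ⧸ S)] [Fintype (G ⧸ S')] [Fintype (S ⧸ S'.subgroupOf S)] in
/-- The tautological comparison `H^q(S'.subgroupOf S, M) → H^q(S', M)` (pull-back along
`toSubgroupOfHom`, identity on `M`). [folklore] -/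
def ofSubgroupOf (h : S' ≤ S) (q : ℕ) :
    continuousCohomology q (repSub S S' ρ).toTopRep ⟶
      continuousCohomology q (ρ.restrict (subgroupIncl S')).toTopRep :=
  ContinuousCohomology.map (toSubgroupOfHom S S' h)
    (TopRep.ofHom ⟨ContinuousLinearMap.id ℤ M, fun _ => rfl⟩) q

/-- The evaluation `F ↦ Ψ(F)(1) = F(1)(1)` along `S' ↪ G` (for the Shapiro map of `M_G^{S'}(M)`
precomposed with `Ψ`). [cite: SerreGaloisCohomology1997, I §2.5] -/
def evalTwice (h : S' ≤ S) :
    TopRep.res (subgroupIncl S' : S' →* G) (coindRep (coindSub S S' ρ)).toTopRep ⟶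
      (ρ.restrict (subgroupIncl S')).toTopRep :=
  TopRep.ofHom
    { toLinearMap := (coindEvalOne (ρ.restrict (subgroupIncl S'))).hom.toLinearMap.comp
        (coindTransHom S S' ρ h).hom.toLinearMap
      cont := continuous_of_discreteTopology
      isIntertwining' := fun s' => by
        ext F
        change (coindEvalOne (ρ.restrict (subgroupIncl S'))).hom
            ((coindTransHom S S' ρ h).hom ((coindRep (coindSub S S' ρ)) (subgroupIncl S' s') F)) =
          (ρ.restrict (subgroupIncl S')) s' ((coindEvalOne (ρ.restrict (subgroupIncl S'))).hom
            ((coindTransHom S S' ρ h).hom F))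
        rw [ContinuousRep.hom_comm_apply (coindTransHom S S' ρ h)]
        exact TopRep.hom_comm_apply (coindEvalOne (ρ.restrict (subgroupIncl S'))) s' _ }

/-- The evaluation `F ↦ F(1)(1)` along `S'.subgroupOf S ↪ S ↪ G` (the composite of the two Shapiro
evaluations). [cite: SerreGaloisCohomology1997, I §2.5] -/
def evalTwice' :
    TopRep.res (((subgroupIncl S).comp (subgroupIncl (S'.subgroupOf S)) :
        (S'.subgroupOf S : Subgroup S) →ₜ* G) : (S'.subgroupOf S : Subgroup S) →* G)
        (coindRep (coindSub S S' ρ)).toTopRep ⟶ (repSub S S' ρ).toTopRep :=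
  TopRep.ofHom
    { toLinearMap := (coindEvalOne (repSub S S' ρ)).hom.toLinearMap.comp
        (coindEvalOne (coindSub S S' ρ)).hom.toLinearMap
      cont := continuous_of_discreteTopology
      isIntertwining' := fun t => by
        ext F
        change ((((F : coindModule (coindSub S S' ρ)) : C(G, coindModule (repSub S S' ρ)))
            (1 * (((t : S) : G))) : coindModule (repSub S S' ρ)) : C(S, M)) 1 =
          ρ ((t : S) : G) (((((F : coindModule (coindSub S S' ρ)) :
            C(G, coindModule (repSub S S' ρ))) 1 : coindModule (repSub S S' ρ)) : C(S, M)) 1)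
        rw [one_mul]
        have e := coe_apply_apply_eq_one S S' ρ F 1 (t : S)
        rw [mul_one] at e
        have hF1 := (mem_coind_iff (repSub S S' ρ) _).1
          (((F : coindModule (coindSub S S' ρ)) : C(G, coindModule (repSub S S' ρ))) 1).2 t 1
        rw [mul_one] at hF1
        exact e.symm.trans hF1 }

omit hS' [Fintype (G ⧸ S)] [Fintype (G ⧸ S')] in
/-- Step 1 of the transitivity: `ext_{G/S} (H(N_{S/S'}) (sh_{G/S} y)) = H(M_G^S(N_{S/S'})) y`
(naturality of the Shapiro map, `shapiro_coindMap`, and `ext = sh⁻¹`). [cite: SerreGaloisCohomology1997, I §2.5] -/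
theorem extMap_cohomologyMap_normCoind_shapiro (q : ℕ)
    (y : continuousCohomology q (coindRep (coindSub S S' ρ)).toTopRep) :
    extMap S ρ q (cohomologyMap (normCoind (S := S'.subgroupOf S) (ρ.restrict (subgroupIncl S))) q
        (ContinuousCohomology.map (subgroupIncl S) (coindEvalOne (coindSub S S' ρ)) q y)) =
      cohomologyMap (coindMap (normCoind (S := S'.subgroupOf S) (ρ.restrict (subgroupIncl S)))) q y := by
  refine extMap_eq_of_shMap_eq S ρ q ?_
  exact (shapiro_coindMap (coindSub S S' ρ) (ρ.restrict (subgroupIncl S)) _ q y).symm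

omit [T2Space G] [TotallyDisconnectedSpace G] hS' [Fintype (G ⧸ S)] [Fintype (G ⧸ S')]
  [Fintype (S ⧸ S'.subgroupOf S)] in
/-- Step 2 of the transitivity: the class `sh_{S/S'} (sh_{G/S} y)`, read over `S'`, is the Shapiro
image `sh_{G/S'} (H(Ψ) y)`. [cite: SerreGaloisCohomology1997, I §2.5] -/
theorem ofSubgroupOf_shMap_shapiro (h : S' ≤ S) (q : ℕ)
    (y : continuousCohomology q (coindRep (coindSub S S' ρ)).toTopRep) :
    ofSubgroupOf S S' ρ h q (shMap (S'.subgroupOf S) (ρ.restrict (subgroupIncl S)) q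
        (ContinuousCohomology.map (subgroupIncl S) (coindEvalOne (coindSub S S' ρ)) q y)) =
      shMap S' ρ q (cohomologyMap (coindTransHom S S' ρ h) q y) := by
  have e1 : ContinuousCohomology.map (subgroupIncl S') (evalTwice S S' ρ h) q y =
      ContinuousCohomology.map (subgroupIncl S') (coindEvalOne (ρ.restrict (subgroupIncl S'))) q
        (cohomologyMap (coindTransHom S S' ρ h) q y) :=
    map_comp_apply_of (ContinuousMonoidHom.id G) (subgroupIncl S') (subgroupIncl S') (fun _ => rfl)
      (resIdHom (coindTransHom S S' ρ h)) (coindEvalOne (ρ.restrict (subgroupIncl S')))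
      (evalTwice S S' ρ h) (fun _ => rfl) q y
  have e2 : ContinuousCohomology.map ((subgroupIncl S).comp (subgroupIncl (S'.subgroupOf S)))
        (evalTwice' S S' ρ) q y =
      shMap (S'.subgroupOf S) (ρ.restrict (subgroupIncl S)) q
        (ContinuousCohomology.map (subgroupIncl S) (coindEvalOne (coindSub S S' ρ)) q y) :=
    map_comp_apply_of (subgroupIncl S) (subgroupIncl (S'.subgroupOf S))
      ((subgroupIncl S).comp (subgroupIncl (S'.subgroupOf S)))
      (fun _ => rfl) (coindEvalOne (coindSub S S' ρ)) (coindEvalOne (repSub S S' ρ))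
      (evalTwice' S S' ρ) (fun _ => rfl) q y
  have e3 : ContinuousCohomology.map (subgroupIncl S') (evalTwice S S' ρ h) q y =
      ofSubgroupOf S S' ρ h q
        (ContinuousCohomology.map ((subgroupIncl S).comp (subgroupIncl (S'.subgroupOf S)))
          (evalTwice' S S' ρ) q y) :=
    map_comp_apply_of ((subgroupIncl S).comp (subgroupIncl (S'.subgroupOf S))) (toSubgroupOfHom S S' h)
      (subgroupIncl S') (fun _ => rfl) (evalTwice' S S' ρ)
      (TopRep.ofHom ⟨ContinuousLinearMap.id ℤ M, fun _ => rfl⟩) (evalTwice S S' ρ h)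
      (fun _ => rfl) q y
  rw [← e1, e3, e2]

/-- Transitivity on classes of the form `sh_{S/S'} (sh_{G/S} y)` (every class is of this form).
[cite: SerreGaloisCohomology1997, I §2.5] -/
theorem cor_cor_shapiro (h : S' ≤ S) (q : ℕ)
    (y : continuousCohomology q (coindRep (coindSub S S' ρ)).toTopRep) :
    cor S ρ q (cor (S'.subgroupOf S) (ρ.restrict (subgroupIncl S)) q
        (shMap (S'.subgroupOf S) (ρ.restrict (subgroupIncl S)) q
          (ContinuousCohomology.map (subgroupIncl S) (coindEvalOne (coindSub S S' ρ)) q y))) =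
      cor S' ρ q (ofSubgroupOf S S' ρ h q
        (shMap (S'.subgroupOf S) (ρ.restrict (subgroupIncl S)) q
          (ContinuousCohomology.map (subgroupIncl S) (coindEvalOne (coindSub S S' ρ)) q y))) := by
  have h1 : cor (S'.subgroupOf S) (ρ.restrict (subgroupIncl S)) q
      (shMap (S'.subgroupOf S) (ρ.restrict (subgroupIncl S)) q
        (ContinuousCohomology.map (subgroupIncl S) (coindEvalOne (coindSub S S' ρ)) q y)) =
      cohomologyMap (normCoind (S := S'.subgroupOf S) (ρ.restrict (subgroupIncl S))) q
        (ContinuousCohomology.map (subgroupIncl S) (coindEvalOne (coindSub S S' ρ)) q y) := by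
    rw [cor_apply, extMap_shMap_all]
  have h2 : cor S ρ q (cohomologyMap (normCoind (S := S'.subgroupOf S) (ρ.restrict (subgroupIncl S))) q
        (ContinuousCohomology.map (subgroupIncl S) (coindEvalOne (coindSub S S' ρ)) q y)) =
      cohomologyMap (coindMap (normCoind (S := S'.subgroupOf S) (ρ.restrict (subgroupIncl S))) ≫
        normCoind (S := S) ρ) q y := by
    rw [cor_apply, extMap_cohomologyMap_normCoind_shapiro, cohomologyMap_comp_apply]
  have h3 : cor S' ρ q (ofSubgroupOf S S' ρ h q
        (shMap (S'.subgroupOf S) (ρ.restrict (subgroupIncl S)) q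
          (ContinuousCohomology.map (subgroupIncl S) (coindEvalOne (coindSub S S' ρ)) q y))) =
      cohomologyMap (coindTransHom S S' ρ h ≫ normCoind (S := S') ρ) q y := by
    rw [ofSubgroupOf_shMap_shapiro, cor_apply, extMap_shMap_all, cohomologyMap_comp_apply]
  -- the two composites `M_G^S(M_S^{S'}(M)) → M` agree
  have hcomp : coindTransHom S S' ρ h ≫ normCoind (S := S') ρ =
      coindMap (normCoind (S := S'.subgroupOf S) (ρ.restrict (subgroupIncl S))) ≫
        normCoind (S := S) ρ :=
    TopRep.hom_ext (DFunLike.ext _ _ fun F => normCoind_coindTransHom S S' ρ h F)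
  exact ((congrArg (fun t => cor S ρ q t) h1).trans h2).trans
    (((congrArg (fun f => cohomologyMap f q y) hcomp).symm).trans h3.symm)

/-- **Transitivity of the corestriction, all degrees (Serre I §2.5; NSW I Prop. 1.5.3 (iii))**:
for closed subgroups `S' ≤ S ≤ G` of finite index of a profinite group and a discrete `G`-module
`M`, `cor_{G/S} (cor_{S/S'} z) = cor_{G/S'} z` for every `z ∈ H^q(S'.subgroupOf S, M)` (read in
`H^q(S', M)` on the right through `ofSubgroupOf`). Here `cor_{S/S'}` is the corestriction `cor` of
the profinite group `↥S` along `S'.subgroupOf S` with coefficients `M|_S`.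
[cite: SerreGaloisCohomology1997, I §2.5] [cite: NeukirchSchmidtWingberg2008, I §5 Prop. 1.5.3 (iii)] -/
theorem cor_cor_subgroupOf (h : S' ≤ S) (q : ℕ)
    (z : continuousCohomology q (repSub S S' ρ).toTopRep) :
    cor S ρ q (cor (S'.subgroupOf S) (ρ.restrict (subgroupIncl S)) q z) =
      cor S' ρ q (ofSubgroupOf S S' ρ h q z) := by
  -- every class `z` is `sh_{S/S'} (sh_{G/S} y)`
  obtain ⟨y, hy⟩ := shapiro_map_surjective (coindSub S S' ρ) q
    (extMap (S'.subgroupOf S) (ρ.restrict (subgroupIncl S)) q z)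
  have hz : shMap (S'.subgroupOf S) (ρ.restrict (subgroupIncl S)) q
      (ContinuousCohomology.map (subgroupIncl S) (coindEvalOne (coindSub S S' ρ)) q y) = z := by
    rw [hy, sh_extMap]
  rw [← hz]
  exact cor_cor_shapiro S S' ρ h q y

end Trans

end Literature.NumberTheory.GaloisRepresentations
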